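import Summits.ValiantsHypothesis.ValiantsHypothesis.Theorems.MatroidMinBaseLevels
import HarnessLib

/-!
# Swap optimality of matroid bases

General matroid optimisation ([KorteVygen2018, Thm 13.23] for bases; the strict/isolation form
is folklore); brick 3, standalone, of the rung-2 infrastructure of the W4 road — the rung-2 road
itself is designed, not built (decomp-valiant bus 1877).  Nothing about hitting sets,
determinants, VP or VNP is proved here; 0 S-currency.

For a matroid `M` on a finite type, a base `B` and a weight `w : α → ℕ`, a *swap* is a base of
the form `insert f (B \ {e})` with `e ∈ B`, `f ∈ M.E`, `f ∉ B`.

* `isBase_insert_sdiff_of_mem_fundCircuit`: along the fundamental circuit of `f ∉ B` every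
  swap is a base (Mathlib's `Matroid.Indep.mem_fundCircuit_iff` and
  `Matroid.IsBase.exchange_isBase_of_indep`, repackaged);
* `min_iff_forall_swap_le` (LOCAL = GLOBAL): `B` has minimum weight among all bases iff no
  swap decreases the weight.  The non-trivial direction goes through the level criterion
  `MatroidMinBaseLevels.min_of_forall_isBasis_levelSet`: if no swap improves, the fundamental
  circuit of any light `f ∉ B` consists of light elements of `B`
  (`Matroid.IsCircuit.mem_closure_sdiff_singleton_of_mem`), so `B ∩ {w ≤ θ}` spans `{w ≤ θ}`;
* `unique_min_iff_forall_swap_lt` (ISOLATION IS LOCAL): `B` is the UNIQUE minimum-weight base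
  iff every swap strictly increases the weight (two fundamental-circuit exchanges against a
  lightest element of `B' \ B`, `Finset.exists_min_image`).
-/

set_option linter.dupNamespace false

namespace Summit.ValiantsHypothesis.ValiantsHypothesis.Theorems.MatroidSwapOptimality

open Finset Matroid Summit.ValiantsHypothesis.ValiantsHypothesis.Theorems.MatroidMinBaseLevels

variable {α : Type*} {M : Matroid α} {w : α → ℕ}

/-! ## §1 Swaps along fundamental circuits (no finiteness needed) -/

/-- The fundamental circuit of `f` in `B`, minus `f`, lies in `B`. -/
theorem fundCircuit_sdiff_subset (f : α) (B : Set α) : M.fundCircuit f B \ {f} ⊆ B :=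
  fun _ hx => (Set.mem_insert_iff.1 (M.fundCircuit_subset_insert f B hx.1)).resolve_left hx.2

/-- Along the fundamental circuit of `f ∉ B` in a base `B`, every swap gives a base. -/
theorem isBase_insert_sdiff_of_mem_fundCircuit {B : Set α} (hB : M.IsBase B) {e f : α}
    (hf : f ∈ M.E) (hfB : f ∉ B) (heB : e ∈ B) (he : e ∈ M.fundCircuit f B) :
    M.IsBase (insert f (B \ {e})) := by
  have hne : f ≠ e := fun h => hfB (h ▸ heB)
  have hcl : f ∈ M.closure B := by rw [hB.closure_eq]; exact hf
  have hind : M.Indep (insert f B \ {e}) := (hB.indep.mem_fundCircuit_iff hcl hfB).1 he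
  rw [← Set.insert_sdiff_singleton_comm hne] at hind
  exact hB.exchange_isBase_of_indep hfB hind

/-- A circuit is not contained in a base. -/
theorem exists_mem_sdiff_notMem_of_isCircuit {B C : Set α} (hB : M.IsBase B)
    (hC : M.IsCircuit C) {f : α} (hfB : f ∈ B) :
    ∃ x ∈ C \ {f}, x ∉ B := by
  by_contra h
  push Not at h
  refine hC.not_indep (hB.indep.subset fun x hx => ?_)
  by_cases hxf : x = f
  · exact hxf ▸ hfB
  · exact h x ⟨hx, hxf⟩

/-- If no swap improves, `B` meets every level set `{w ≤ θ}` in a basis of it. -/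
theorem isBasis_levelSet_of_forall_swap_le {B : Set α} (hB : M.IsBase B)
    (hloc : ∀ e ∈ B, ∀ f ∈ M.E, f ∉ B → M.IsBase (insert f (B \ {e})) → w e ≤ w f) (θ : ℕ) :
    M.IsBasis (B ∩ levelSet M w θ) (levelSet M w θ) := by
  refine (hB.indep.inter_right _).isBasis_of_subset_of_subset_closure
    Set.inter_subset_right fun f hf => ?_
  by_cases hfB : f ∈ B
  · exact M.subset_closure (B ∩ levelSet M w θ)
      (Set.inter_subset_right.trans (levelSet_subset_ground M w θ)) ⟨hfB, hf⟩
  have hC := hB.fundCircuit_isCircuit hf.1 hfB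
  have hsub : M.fundCircuit f B \ {f} ⊆ B ∩ levelSet M w θ := by
    intro x hx
    have hxB : x ∈ B := fundCircuit_sdiff_subset f B hx
    exact ⟨hxB, hB.subset_ground hxB, (hloc x hxB f hf.1 hfB
      (isBase_insert_sdiff_of_mem_fundCircuit hB hf.1 hfB hxB hx.1)).trans hf.2⟩
  exact M.closure_subset_closure hsub
    (hC.mem_closure_sdiff_singleton_of_mem (M.mem_fundCircuit f B))

/-! ## §2 Weight bookkeeping of a swap -/

variable [Fintype α]

/-- Inserting a new element adds its weight. -/
theorem wt_insert {S : Set α} {f : α} (hf : f ∉ S) : wt w (insert f S) = w f + wt w S := by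
  classical
  have h : fs (insert f S) = insert f (fs S) := by ext x; simp [mem_fs]
  unfold wt
  rw [h, Finset.sum_insert (by simpa [mem_fs] using hf)]

/-- Removing an element subtracts its weight. -/
theorem wt_eq_add_wt_sdiff {S : Set α} {e : α} (he : e ∈ S) :
    wt w S = w e + wt w (S \ {e}) := by
  have h : insert e (S \ {e}) = S := by
    ext x
    by_cases hx : x = e <;> simp [hx, he]
  conv_lhs => rw [← h]
  exact wt_insert fun hx => hx.2 rfl

/-- The weight of a swap. -/
theorem wt_swap {B : Set α} {e f : α} (he : e ∈ B) (hfB : f ∉ B) :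
    wt w (insert f (B \ {e})) + w e = wt w B + w f := by
  rw [wt_insert (show f ∉ B \ {e} from fun h => hfB h.1), wt_eq_add_wt_sdiff (w := w) he]
  ring

/-! ## §3 Minimum weight is a local property ([KorteVygen2018, Thm 13.23]) -/

/-- A minimum-weight base admits no improving swap. -/
theorem swap_le_of_min {B : Set α} (hmin : ∀ B', M.IsBase B' → wt w B ≤ wt w B') {e f : α}
    (he : e ∈ B) (hfB : f ∉ B) (hsw : M.IsBase (insert f (B \ {e}))) : w e ≤ w f := by
  have h1 := hmin _ hsw
  have h2 := wt_swap (w := w) he hfB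
  omega

/-- If no swap improves, `B` has minimum weight (via the level criterion of
`MatroidMinBaseLevels.min_of_forall_isBasis_levelSet`). -/
theorem min_of_forall_swap_le {B : Set α} (hB : M.IsBase B)
    (hloc : ∀ e ∈ B, ∀ f ∈ M.E, f ∉ B → M.IsBase (insert f (B \ {e})) → w e ≤ w f) :
    ∀ B', M.IsBase B' → wt w B ≤ wt w B' :=
  fun _ hB' => min_of_forall_isBasis_levelSet hB (isBasis_levelSet_of_forall_swap_le hB hloc) hB'

/-- LOCAL = GLOBAL ([KorteVygen2018, Thm 13.23] for bases): a base has minimum weight iff no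
swap decreases the weight. -/
theorem min_iff_forall_swap_le {B : Set α} (hB : M.IsBase B) :
    (∀ B', M.IsBase B' → wt w B ≤ wt w B') ↔
      ∀ e ∈ B, ∀ f ∈ M.E, f ∉ B → M.IsBase (insert f (B \ {e})) → w e ≤ w f :=
  ⟨fun hmin _ he _ _ hfB hsw => swap_le_of_min hmin he hfB hsw, min_of_forall_swap_le hB⟩

/-- Contrapositive: a base that is not of minimum weight has an improving swap. -/
theorem exists_improving_swap {B B' : Set α} (hB : M.IsBase B) (hB' : M.IsBase B')
    (hlt : wt w B' < wt w B) :
    ∃ e ∈ B, ∃ f ∈ M.E, f ∉ B ∧ M.IsBase (insert f (B \ {e})) ∧ w f < w e := by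
  by_contra h
  push Not at h
  exact absurd (min_of_forall_swap_le hB (fun e he f hf hfB hsw => h e he f hf hfB hsw) B' hB')
    (not_le.2 hlt)

/-! ## §4 Isolation is local: the unique minimum -/

/-- If every swap strictly increases the weight, no other base has the same weight. -/
theorem eq_of_forall_swap_lt {B : Set α} (hB : M.IsBase B)
    (hloc : ∀ e ∈ B, ∀ f ∈ M.E, f ∉ B → M.IsBase (insert f (B \ {e})) → w e < w f)
    {B' : Set α} (hB' : M.IsBase B') (hwt : wt w B' = wt w B) : B' = B := by
  classical
  have hmin : ∀ B'', M.IsBase B'' → wt w B ≤ wt w B'' :=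
    min_of_forall_swap_le hB fun e he f hf hfB hsw => (hloc e he f hf hfB hsw).le
  have hmin' : ∀ B'', M.IsBase B'' → wt w B' ≤ wt w B'' := fun B'' h => hwt ▸ hmin B'' h
  by_contra hne
  have hnon : (fs (B' \ B)).Nonempty := by
    rw [← Finset.coe_nonempty, coe_fs, Set.nonempty_iff_ne_empty]
    intro h0
    exact hne (hB'.eq_of_subset_isBase hB (Set.sdiff_eq_empty.1 h0))
  obtain ⟨f, hfD, hfmin⟩ := Finset.exists_min_image (fs (B' \ B)) w hnon
  rw [mem_fs] at hfD
  have hfE : f ∈ M.E := hB'.subset_ground hfD.1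
  -- a swap partner `x ∈ B \ B'` of `f` in `B`, strictly lighter than `f`
  obtain ⟨x, hx, hxB'⟩ :=
    exists_mem_sdiff_notMem_of_isCircuit hB' (hB.fundCircuit_isCircuit hfE hfD.2) hfD.1
  have hxB : x ∈ B := fundCircuit_sdiff_subset f B hx
  have hxf : w x < w f :=
    hloc x hxB f hfE hfD.2 (isBase_insert_sdiff_of_mem_fundCircuit hB hfE hfD.2 hxB hx.1)
  -- a swap partner `y ∈ B' \ B` of `x` in `B'`, not heavier than `x`
  obtain ⟨y, hy, hyB⟩ :=
    exists_mem_sdiff_notMem_of_isCircuit hB (hB'.fundCircuit_isCircuit (hB.subset_ground hxB)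
      hxB') hxB
  have hyB' : y ∈ B' := fundCircuit_sdiff_subset x B' hy
  have hyx : w y ≤ w x := swap_le_of_min hmin' hyB' hxB'
    (isBase_insert_sdiff_of_mem_fundCircuit hB' (hB.subset_ground hxB) hxB' hyB' hy.1)
  have hfy : w f ≤ w y := hfmin y (mem_fs.2 ⟨hyB', hyB⟩)
  omega

/-- ISOLATION IS LOCAL: `B` is the unique minimum-weight base iff every swap strictly
increases the weight. -/
theorem unique_min_iff_forall_swap_lt {B : Set α} (hB : M.IsBase B) :
    (∀ B', M.IsBase B' → B' ≠ B → wt w B < wt w B') ↔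
      ∀ e ∈ B, ∀ f ∈ M.E, f ∉ B → M.IsBase (insert f (B \ {e})) → w e < w f := by
  refine ⟨fun h e he f _ hfB hsw => ?_, fun hloc B' hB' hne => ?_⟩
  · have hne : insert f (B \ {e}) ≠ B := fun hEq => hfB (hEq ▸ Set.mem_insert f (B \ {e}))
    have h1 := h _ hsw hne
    have h2 := wt_swap (w := w) he hfB
    omega
  · have hmin := min_of_forall_swap_le hB fun e he f hf hfB hsw => (hloc e he f hf hfB hsw).le
    rcases (hmin B' hB').lt_or_eq with hlt | heq
    · exact hlt
    · exact absurd (eq_of_forall_swap_lt hB hloc hB' heq.symm) hne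

/-- A unique minimum-weight base exists iff some base has only strictly increasing swaps. -/
theorem existsUnique_min_iff :
    (∃ B, M.IsBase B ∧ ∀ B', M.IsBase B' → B' ≠ B → wt w B < wt w B') ↔
      ∃ B, M.IsBase B ∧
        ∀ e ∈ B, ∀ f ∈ M.E, f ∉ B → M.IsBase (insert f (B \ {e})) → w e < w f :=
  ⟨fun ⟨B, hB, h⟩ => ⟨B, hB, (unique_min_iff_forall_swap_lt hB).1 h⟩,
    fun ⟨B, hB, h⟩ => ⟨B, hB, (unique_min_iff_forall_swap_lt hB).2 h⟩⟩

end Summit.ValiantsHypothesis.ValiantsHypothesis.Theorems.MatroidSwapOptimality
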